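import Literature.NumberTheory.Transcendental.WeakCITLogPoint
import Literature.NumberTheory.Transcendental.RosenlichtDifferentials
import HarnessLib

/-!
# Horizontal weak Zilber–Pink, step 2: logarithmic points of irreducible subvarieties of
`𝔾ₐ^{N'} × 𝔾ₘ^m`, with a `y`-first transcendence basis

Support file for the uniform horizontal weak Zilber–Pink theorem (Bays–Kirby 2018, Thm 11.4 /
Fact 11.3; Kirby 2009, Thm 4.6), companion of `WeakCITGenericPoint.lean` / `WeakCITLogPoint.lean`
(the one-block case used for `weakCIT_holds`). For a prime `P ⊆ ℂ[U, Y]`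
(`U = (U_s)_{s < N'}`, `Y = (Y_i)_{i < m}`, no `Y_i` in `P`) we construct the data fed to the
one-field Schanuel bound `WeakZP.exists_int_relation_rel` (`WeakZPSchanuel.lean`):

* the function field `K = Frac(ℂ[U, Y] ⧸ P)` with its generic point `(u, y)`;
* a transcendence basis `B` of `K/ℂ` among the coordinates chosen **`y`-first**: `B ∩ y = B_y`
  is a transcendence basis of `ℂ(y)` (a basis of `range y` in the algebraic matroid, extended to
  a basis of all coordinates), with index sets `S_y ⊆ Fin m`, `S_u ⊆ Fin N'`;
* dual derivations `∂_b` (`∂_b b' = δ_{bb'} w_b`, `w_b = b` for `b ∈ B_y` — Euler type — and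
  `w_b = 1` for `b ∈ B ∖ B_y`), whose common constants are `ℂ`, and such that `∂_b` kills
  `ℂ(y)` for `b ∈ B ∖ B_y` (the `y`-first choice);
* the field `L = K(x₁, …, x_m)` of formal logarithms and derivations `D_j` of `L`
  (`j : Fin (N' + m)` ↔ coordinates via `finSumFinEquiv`) with `D yᵢ = yᵢ D xᵢ`, Jacobian the
  identity on `S_y` (for the `x`'s) and on `S_u` (for the `u`'s), `D_{(s)}` killing `y` for
  `s ∈ S_u`, constant Laurent monomials in `y` being complex numbers, and `|S_y| + |S_u| = dim`.

Everything is packaged in `WeakZP.LogPointG` (`WeakZP.exists_logPointG`).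

## References

* J. Kirby, *The theory of the exponential differential equations of semiabelian varieties*,
  Selecta Math. 15 (2009), Thm 4.6 (proof).
* M. Bays, J. Kirby, *Pseudo-exponential maps, variants, and quasiminimality*, ANT 12 (2018),
  Thm 11.4 (proof: "by considering dimensions of fibres").
* M. Rosenlicht, *On Liouville's theory of elementary functions*, Pacific J. Math. 65 (1976), Prop. 3.
-/

noncomputable section

open MvPolynomial Set

namespace Literature.NumberTheory.Transcendental.WeakZP

open WeakCIT

variable {N' m : ℕ}

/-! ### The data: two-block logarithmic points -/

/-- A **two-block logarithmic point** for `𝔾ₐ^{N'} × 𝔾ₘ^m`: a field `F ⊇ ℂ` of characteristic zero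
with derivations `D_j` (`j : Fin (N' + m)`), an additive block `u ∈ F^{N'}`, a torus point
`y ∈ (Fˣ)^m` with logarithms `x` (`D yᵢ = yᵢ D xᵢ`), index sets `S_y ⊆ Fin m`, `S_u ⊆ Fin N'` on
which the Jacobian (w.r.t. `x` resp. `u`) is the identity, the derivations of index in `S_u`
killing `y`, and a prime `P ⊆ ℂ[U, Y]` of which `(u, y)` is a generic zero, of dimension
`|S_y| + |S_u|`, such that constant Laurent monomials in `y` are complex numbers.
[cite: Kirby2009, Thm 4.6 (proof)] [cite: BaysKirby2018ANT, Thm 11.4 (proof)] -/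
structure LogPointG (N' m : ℕ) : Type 1 where
  /-- The differential field. -/
  F : Type
  [instField : Field F]
  [instCharZero : CharZero F]
  [instAlgebra : Algebra ℂ F]
  /-- The additive block. -/
  u : Fin N' → F
  /-- The logarithms of the torus block. -/
  x : Fin m → F
  /-- The torus block. -/
  y : Fin m → F
  /-- The derivations. -/
  D : Fin (N' + m) → Derivation ℂ F F
  /-- Basis indices in the torus block. -/
  Sy : Finset (Fin m)
  /-- Basis indices in the additive block. -/
  Su : Finset (Fin N')
  /-- The prime ideal of which `(u, y)` is a generic zero. -/
  P : Ideal (MvPolynomial (Fin N' ⊕ Fin m) ℂ)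
  y_ne_zero : ∀ i, y i ≠ 0
  map_y : ∀ j i, D j (y i) = y i * D j (x i)
  map_x : ∀ i ∈ Sy, ∀ j, D j (x i) = (Pi.single (finSumFinEquiv (Sum.inr i)) (1 : F) : _ → F) j
  map_u : ∀ s ∈ Su, ∀ j, D j (u s) = (Pi.single (finSumFinEquiv (Sum.inl s)) (1 : F) : _ → F) j
  map_u_y : ∀ s ∈ Su, ∀ i, D (finSumFinEquiv (Sum.inl s)) (y i) = 0
  aeval_eq_zero_iff : ∀ p : MvPolynomial (Fin N' ⊕ Fin m) ℂ, aeval (Sum.elim u y) p = 0 ↔ p ∈ P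
  exists_eq_algebraMap : ∀ q : Fin m → ℤ, (∀ j, D j (∏ i, y i ^ q i) = 0) →
    ∃ c : ℂ, ∏ i, y i ^ q i = algebraMap ℂ F c
  card_S : (((Sy.card + Su.card : ℕ) : ℕ∞) : WithBot ℕ∞) =
    ringKrullDim (MvPolynomial (Fin N' ⊕ Fin m) ℂ ⧸ P)

attribute [instance] LogPointG.instField LogPointG.instCharZero LogPointG.instAlgebra

/-! ### Coordinate ring, function field, generic point -/

section GenericPoint

variable (P : Ideal (MvPolynomial (Fin N' ⊕ Fin m) ℂ))

/-- The coordinate ring `ℂ[U, Y] ⧸ P`. [folklore] -/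
abbrev CoordRingG : Type := MvPolynomial (Fin N' ⊕ Fin m) ℂ ⧸ P

/-- The function field `Frac(ℂ[U, Y] ⧸ P)`. [folklore] -/
abbrev FuncFieldG : Type := FractionRing (CoordRingG P)

/-- The coordinate classes. [folklore] -/
def coordG (c : Fin N' ⊕ Fin m) : CoordRingG P := Ideal.Quotient.mk P (X c)

/-- The generic point `(u, y) ∈ K^{N' ⊕ m}` of `Z(P)`, `K = Frac(ℂ[U, Y] ⧸ P)`. [cite: Marker2006, §1] -/
def genPtG (c : Fin N' ⊕ Fin m) : FuncFieldG P :=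
  algebraMap (CoordRingG P) (FuncFieldG P) (coordG P c)

/-- Evaluation at the coordinate classes is the quotient map. [folklore] -/
theorem aeval_coordG (p : MvPolynomial (Fin N' ⊕ Fin m) ℂ) :
    aeval (coordG P) p = Ideal.Quotient.mk P p := by
  have : (aeval (coordG P) : MvPolynomial (Fin N' ⊕ Fin m) ℂ →ₐ[ℂ] CoordRingG P) =
      Ideal.Quotient.mkₐ ℂ P :=
    MvPolynomial.algHom_ext fun i => by simp [coordG]
  rw [this]
  rfl

/-- Evaluation at the generic point is the class in the function field. [folklore] -/
theorem aeval_genPtG (p : MvPolynomial (Fin N' ⊕ Fin m) ℂ) :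
    aeval (genPtG P) p = algebraMap (CoordRingG P) (FuncFieldG P) (Ideal.Quotient.mk P p) := by
  have : (aeval (genPtG P) : MvPolynomial (Fin N' ⊕ Fin m) ℂ →ₐ[ℂ] FuncFieldG P) =
      (IsScalarTower.toAlgHom ℂ (CoordRingG P) (FuncFieldG P)).comp (aeval (coordG P)) :=
    MvPolynomial.algHom_ext fun i => by simp [genPtG, coordG]
  rw [this, AlgHom.comp_apply, aeval_coordG]
  rfl

/-- **`I((u, y)/ℂ) = P`**. [cite: Marker2006, §1] -/
theorem aeval_genPtG_eq_zero_iff (p : MvPolynomial (Fin N' ⊕ Fin m) ℂ) :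
    aeval (genPtG P) p = 0 ↔ p ∈ P := by
  rw [aeval_genPtG, map_eq_zero_iff _ (IsFractionRing.injective (CoordRingG P) (FuncFieldG P)),
    Ideal.Quotient.eq_zero_iff_mem]

/-- Coordinates not in `P` are non-zero at the generic point. [folklore] -/
theorem genPtG_ne_zero {c : Fin N' ⊕ Fin m} (hc : (X c : MvPolynomial (Fin N' ⊕ Fin m) ℂ) ∉ P) :
    genPtG P c ≠ 0 := by
  intro h
  apply hc
  rw [← aeval_genPtG_eq_zero_iff P (X c), aeval_X]
  exact h

/-- `Sum.elim` of the two blocks of the generic point is the generic point. [folklore] -/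
theorem sum_elim_genPtG :
    Sum.elim (genPtG P ∘ Sum.inl) (genPtG P ∘ Sum.inr) = genPtG P := by
  funext c; cases c <;> rfl

end GenericPoint

/-! ### A `y`-first transcendence basis among the coordinate classes -/

section Basis

variable (P : Ideal (MvPolynomial (Fin N' ⊕ Fin m) ℂ)) [P.IsPrime]

omit [P.IsPrime] in
/-- The coordinate classes generate the coordinate ring. [folklore] -/
theorem adjoin_range_coordG : Algebra.adjoin ℂ (Set.range (coordG P)) = ⊤ := by
  rw [Algebra.adjoin_range_eq_range_aeval, AlgHom.range_eq_top]
  intro a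
  obtain ⟨p, rfl⟩ := Ideal.Quotient.mk_surjective a
  exact ⟨p, aeval_coordG P p⟩

/-- The coordinate ring is a faithful `ℂ`-algebra (instance for this file). [folklore] -/
instance faithfulSMul_coordRingG : FaithfulSMul ℂ (CoordRingG P) :=
  (faithfulSMul_iff_algebraMap_injective ℂ (CoordRingG P)).2 (algebraMap ℂ (CoordRingG P)).injective

/-- The set of `y`-coordinate classes. [folklore] -/
def ySet : Set (CoordRingG P) := Set.range (coordG P ∘ Sum.inr)

/-- **A `y`-first transcendence basis among the coordinate classes**: there are
`B_y ⊆ B ⊆ {coordinate classes}` with `B_y` a basis of the `y`-classes in the algebraic matroid of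
`ℂ[U, Y] ⧸ P` over `ℂ`, `B` a transcendence basis, and `B ∩ {y-classes} = B_y`. [folklore] -/
theorem exists_bases : ∃ p : Set (CoordRingG P) × Set (CoordRingG P),
    (AlgebraicIndependent.matroid ℂ (CoordRingG P)).IsBasis p.1 (ySet P) ∧ p.1 ⊆ p.2 ∧
    p.2 ⊆ Set.range (coordG P) ∧ IsTranscendenceBasis ℂ ((↑) : p.2 → CoordRingG P) ∧
    p.2 ∩ ySet P = p.1 := by
  classical
  set M := AlgebraicIndependent.matroid ℂ (CoordRingG P) with hM
  obtain ⟨By, hBy⟩ := M.exists_isBasis (ySet P) (Set.subset_univ _)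
  have hYA : ySet P ⊆ Set.range (coordG P) := by
    rintro _ ⟨i, rfl⟩; exact ⟨Sum.inr i, rfl⟩
  obtain ⟨B, hB, hByB⟩ := hBy.indep.subset_isBasis_of_subset (hBy.subset.trans hYA)
    (Set.subset_univ _)
  -- `B` is a base: the coordinate classes span
  have hspan : M.Spanning (Set.range (coordG P)) := by
    rw [hM, AlgebraicIndependent.matroid_spanning_iff, adjoin_range_coordG]
    exact ⟨fun a => isAlgebraic_algebraMap (⟨a, Algebra.mem_top⟩ : (⊤ : Subalgebra ℂ (CoordRingG P)))⟩
  have hbase : M.IsBase B := hB.isBase_of_spanning hspan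
  refine ⟨(By, B), hBy, hByB, hB.subset, AlgebraicIndependent.matroid_isBase_iff.1 hbase, ?_⟩
  apply Set.Subset.antisymm
  · rintro a ⟨haB, haY⟩
    by_contra haBy
    have h1 : a ∈ M.closure By := hBy.subset_closure haY
    have h2 : M.closure By ⊆ M.closure (B \ {a}) :=
      M.closure_subset_closure fun b hb => ⟨hByB hb, fun hba => haBy (hba ▸ hb)⟩
    exact hbase.indep.notMem_closure_sdiff_of_mem haB (h2 h1)
  · exact fun a ha => ⟨hByB ha, hBy.subset ha⟩

/-- The `y`-part `B_y` of the chosen basis. [folklore] -/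
def basisY : Set (CoordRingG P) := (exists_bases P).choose.1

/-- The chosen transcendence basis `B` among the coordinate classes. [folklore] -/
def basisAll : Set (CoordRingG P) := (exists_bases P).choose.2

/-- `B_y` is a basis of the `y`-classes. [folklore] -/
theorem isBasis_basisY : (AlgebraicIndependent.matroid ℂ (CoordRingG P)).IsBasis (basisY P) (ySet P) :=
  (exists_bases P).choose_spec.1

/-- `B_y ⊆ B`. [folklore] -/
theorem basisY_subset_basisAll : basisY P ⊆ basisAll P := (exists_bases P).choose_spec.2.1

/-- `B` consists of coordinate classes. [folklore] -/
theorem basisAll_subset : basisAll P ⊆ Set.range (coordG P) := (exists_bases P).choose_spec.2.2.1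

/-- `B` is a transcendence basis. [folklore] -/
theorem isTranscendenceBasis_basisAll : IsTranscendenceBasis ℂ ((↑) : basisAll P → CoordRingG P) :=
  (exists_bases P).choose_spec.2.2.2.1

/-- `B ∩ {y-classes} = B_y`. [folklore] -/
theorem basisAll_inter_ySet : basisAll P ∩ ySet P = basisY P := (exists_bases P).choose_spec.2.2.2.2

/-- The coordinate of a basis element: a `y`-coordinate if possible. [folklore] -/
def cof (b : basisAll P) : Fin N' ⊕ Fin m := by
  classical
  exact if h : (b : CoordRingG P) ∈ ySet P then Sum.inr h.choose
    else (basisAll_subset P b.2).choose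

/-- A basis element outside the `y`-classes is a `u`-class, and `cof` picks a `u`-coordinate.
[folklore] -/
theorem cof_spec (b : basisAll P) : coordG P (cof P b) = b := by
  classical
  unfold cof
  split_ifs with h
  · exact h.choose_spec
  · exact (basisAll_subset P b.2).choose_spec

/-- For `b ∉ {y-classes}`, `cof b` is an additive coordinate. [folklore] -/
theorem cof_isLeft_of_not_mem {b : basisAll P} (h : (b : CoordRingG P) ∉ ySet P) :
    ∃ s, cof P b = Sum.inl s := by
  classical
  have hc := cof_spec P b
  unfold cof at hc ⊢
  rw [dif_neg h] at hc ⊢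
  rcases hcb : (basisAll_subset P b.2).choose with s | i
  · exact ⟨s, rfl⟩
  · exfalso
    rw [hcb] at hc
    exact h ⟨i, hc⟩

/-- For `b ∈ {y-classes}`, `cof b` is a torus coordinate. [folklore] -/
theorem cof_isRight_of_mem {b : basisAll P} (h : (b : CoordRingG P) ∈ ySet P) :
    ∃ i, cof P b = Sum.inr i := by
  classical
  unfold cof
  rw [dif_pos h]
  exact ⟨_, rfl⟩

/-- `cof` is injective. [folklore] -/
theorem cof_injective : Function.Injective (cof P) := fun a b h =>
  Subtype.ext (by rw [← cof_spec P a, ← cof_spec P b, h])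

/-- The basis is finite (instance for this file). [folklore] -/
instance fintypeBasisAll : Fintype (basisAll P) := by
  classical
  exact Fintype.ofInjective (cof P) (cof_injective P)

/-- The index set `S_y ⊆ Fin m` of basis `y`-coordinates. [folklore] -/
def Sy : Finset (Fin m) := by
  classical
  exact Finset.univ.filter fun i => Sum.inr i ∈ Set.range (cof P)

/-- The index set `S_u ⊆ Fin N'` of basis `u`-coordinates. [folklore] -/
def Su : Finset (Fin N') := by
  classical
  exact Finset.univ.filter fun s => Sum.inl s ∈ Set.range (cof P)

/-- Membership in `Sy`. [folklore] -/
theorem mem_Sy_iff {i : Fin m} : i ∈ Sy P ↔ Sum.inr i ∈ Set.range (cof P) := by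
  classical
  simp [Sy]

/-- Membership in `Su`. [folklore] -/
theorem mem_Su_iff {s : Fin N'} : s ∈ Su P ↔ Sum.inl s ∈ Set.range (cof P) := by
  classical
  simp [Su]

/-- **`|S_y| + |S_u| = dim`**: the basis indices count the Krull dimension of `ℂ[U, Y] ⧸ P`.
[cite: Matsumura1987, Thm 5.6] -/
theorem card_Sy_add_card_Su :
    ((((Sy P).card + (Su P).card : ℕ) : ℕ∞) : WithBot ℕ∞) = ringKrullDim (CoordRingG P) := by
  classical
  -- `S_y ⊕ S_u ≃ B` via `cof`
  have hcard : (Sy P).card + (Su P).card = Fintype.card (basisAll P) := by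
    have h1 : Fintype.card (basisAll P) = (Finset.univ.image (cof P)).card := by
      rw [Finset.card_image_of_injective _ (cof_injective P), Finset.card_univ]
    have h2 : Finset.univ.image (cof P) =
        (Su P).map ⟨Sum.inl, Sum.inl_injective⟩ ∪ (Sy P).map ⟨Sum.inr, Sum.inr_injective⟩ := by
      ext c
      simp only [Finset.mem_image, Finset.mem_univ, true_and, Finset.mem_union, Finset.mem_map,
        Function.Embedding.coeFn_mk, mem_Su_iff, mem_Sy_iff, Set.mem_range]
      constructor
      · rintro ⟨b, rfl⟩
        rcases hc : cof P b with s | i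
        · exact Or.inl ⟨s, ⟨b, hc⟩, rfl⟩
        · exact Or.inr ⟨i, ⟨b, hc⟩, rfl⟩
      · rintro (⟨s, ⟨b, hb⟩, rfl⟩ | ⟨i, ⟨b, hb⟩, rfl⟩)
        · exact ⟨b, hb⟩
        · exact ⟨b, hb⟩
    have h3 : Disjoint ((Su P).map ⟨Sum.inl, Sum.inl_injective⟩)
        ((Sy P).map ⟨Sum.inr, Sum.inr_injective⟩) := by
      rw [Finset.disjoint_left]
      rintro c hc1 hc2
      simp only [Finset.mem_map, Function.Embedding.coeFn_mk] at hc1 hc2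
      obtain ⟨s, -, rfl⟩ := hc1
      obtain ⟨i, -, h⟩ := hc2
      exact Sum.inl_ne_inr h.symm
    rw [h1, h2, Finset.card_union_of_disjoint h3, Finset.card_map, Finset.card_map, add_comm]
  have h3 : Cardinal.mk (basisAll P) = Algebra.trdeg ℂ (CoordRingG P) :=
    (isTranscendenceBasis_basisAll P).cardinalMk_eq_trdeg
  rw [Literature.RingTheory.KrullDimension.ringKrullDim_eq_trdeg ℂ (CoordRingG P), ← h3,
    Cardinal.mk_fintype, Cardinal.toNat_natCast, hcard]
  rfl

/-! ### Dual derivations of the function field -/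

/-- The function field has characteristic zero (instance for this file). [folklore] -/
instance charZero_funcFieldG : CharZero (FuncFieldG P) :=
  charZero_of_injective_algebraMap (algebraMap ℂ (FuncFieldG P)).injective

/-- The function field is algebraic over the coordinate ring (instance for this file).
[folklore] -/
instance isAlgebraic_funcFieldG : Algebra.IsAlgebraic (CoordRingG P) (FuncFieldG P) :=
  IsLocalization.isAlgebraic (FuncFieldG P) (nonZeroDivisors (CoordRingG P))

/-- The coordinate ring embeds in its function field (instance for this file). [folklore] -/
instance faithfulSMul_funcFieldG : FaithfulSMul (CoordRingG P) (FuncFieldG P) :=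
  (faithfulSMul_iff_algebraMap_injective _ _).mpr (IsFractionRing.injective (CoordRingG P) (FuncFieldG P))

/-- The basis mapped to the function field. [folklore] -/
def bK (b : basisAll P) : FuncFieldG P := algebraMap (CoordRingG P) (FuncFieldG P) b

/-- `bK b` is the corresponding coordinate of the generic point. [folklore] -/
theorem genPtG_cof (b : basisAll P) : genPtG P (cof P b) = bK P b := by
  rw [genPtG, cof_spec]; rfl

/-- The basis, mapped to the function field, is a transcendence basis of `K/ℂ`. [folklore] -/
theorem isTranscendenceBasis_bK : IsTranscendenceBasis ℂ (bK P) :=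
  (isTranscendenceBasis_basisAll P).algebraMap_comp

/-- The weights of the dual derivations: `w_b = b` on `y`-classes (Euler type), `1` otherwise.
[folklore] -/
def wt (b : basisAll P) : FuncFieldG P := by
  classical
  exact if (b : CoordRingG P) ∈ ySet P then bK P b else 1

/-- The weights are non-zero when no `Y_i` lies in `P`. [folklore] -/
theorem wt_ne_zero (hP : ∀ i, (X (Sum.inr i) : MvPolynomial (Fin N' ⊕ Fin m) ℂ) ∉ P)
    (b : basisAll P) : wt P b ≠ 0 := by
  classical
  unfold wt
  split_ifs with h
  · obtain ⟨i, hi⟩ := h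
    rw [bK, ← hi]
    exact genPtG_ne_zero P (hP i)
  · exact one_ne_zero

open Classical in
/-- For each basis element `a` there is a `ℂ`-derivation `∂ₐ` of `K` with `∂ₐ b = δ_{ab} w_b` on
the basis (derivations with prescribed values on an algebraically independent family).
[cite: Rosenlicht1976, Prop. 3] -/
theorem exists_dualDerivation (a : basisAll P) :
    ∃ δ : Derivation ℂ (FuncFieldG P) (FuncFieldG P), ∀ b : basisAll P,
      δ (bK P b) = if a = b then wt P b else 0 := by
  classical
  exact exists_derivation_of_algebraicIndependent (k := ℂ) (K := FuncFieldG P)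
    (isTranscendenceBasis_bK P).1 (fun b => if a = b then wt P b else 0)

open Classical in
/-- The dual derivations `∂ₐ`. [folklore] -/
def dualDer (a : basisAll P) : Derivation ℂ (FuncFieldG P) (FuncFieldG P) :=
  (exists_dualDerivation P a).choose

open Classical in
/-- `∂ₐ b = δ_{ab} w_b`. [folklore] -/
theorem dualDer_bK (a b : basisAll P) : dualDer P a (bK P b) = if a = b then wt P b else 0 :=
  (exists_dualDerivation P a).choose_spec b

/-- **Constants of the dual derivations are complex numbers.** [cite: Rosenlicht1976, Prop. 3] -/
theorem mem_range_of_forall_dualDer_eq_zero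
    (hP : ∀ i, (X (Sum.inr i) : MvPolynomial (Fin N' ⊕ Fin m) ℂ) ∉ P) {z : FuncFieldG P}
    (hz : ∀ a, dualDer P a z = 0) : z ∈ Set.range (algebraMap ℂ (FuncFieldG P)) := by
  classical
  apply mem_range_algebraMap_of_isAlgebraic
  by_contra hzt
  obtain ⟨δ, hδ1⟩ := exists_derivation_eq_one_of_transcendental (k := ℂ) (K := FuncFieldG P) hzt
  suffices h : δ z = 0 by rw [h] at hδ1; exact zero_ne_one hδ1
  set c : basisAll P → FuncFieldG P := fun a => δ (bK P a) * (wt P a)⁻¹ with hc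
  have hsum : ∀ w, (∑ a, c a • dualDer P a) w = ∑ a, c a * dualDer P a w := by
    intro w
    have h := congrFun (map_sum Derivation.coeFnAddMonoidHom
      (fun a => c a • dualDer P a) Finset.univ) w
    rw [Derivation.coeFnAddMonoidHom_apply, Finset.sum_apply] at h
    rw [h]
    refine Finset.sum_congr rfl fun a _ => ?_
    rw [Derivation.coeFnAddMonoidHom_apply, Derivation.coe_smul, Pi.smul_apply, smul_eq_mul]
  set δ' : Derivation ℂ (FuncFieldG P) (FuncFieldG P) := δ - ∑ a, c a • dualDer P a with hδ'
  have hδ'e : ∀ b, δ' (bK P b) = 0 := by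
    intro b
    rw [hδ', Derivation.sub_apply, hsum, sub_eq_zero]
    have : ∀ a, c a * dualDer P a (bK P b) = if a = b then δ (bK P b) else 0 := by
      intro a
      rw [dualDer_bK]
      split_ifs with hab
      · subst hab
        rw [hc]
        show δ (bK P a) * (wt P a)⁻¹ * wt P a = δ (bK P a)
        rw [inv_mul_cancel_right₀ (wt_ne_zero P hP a)]
      · rw [mul_zero]
    simp only [this, Finset.sum_ite_eq', Finset.mem_univ, if_true]
  set F' : IntermediateField ℂ (FuncFieldG P) := IntermediateField.adjoin ℂ (Set.range (bK P)) with hF'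
  haveI : CharZero F' := charZero_of_injective_algebraMap (algebraMap ℂ F').injective
  haveI : Algebra.IsAlgebraic F' (FuncFieldG P) := (isTranscendenceBasis_bK P).isAlgebraic_field
  have hF'0 : ∀ w : F', δ' (algebraMap F' (FuncFieldG P) w) = 0 := fun w =>
    derivation_eq_zero_on_adjoin δ' (fun r => δ'.map_algebraMap r)
      (by rintro _ ⟨b, rfl⟩; exact hδ'e b) w.2
  have hz' : δ' z = 0 :=
    derivation_eq_zero_of_isAlgebraic δ' hF'0 (Algebra.IsAlgebraic.isAlgebraic z)
  rw [hδ', Derivation.sub_apply, hsum, sub_eq_zero] at hz'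
  rw [hz']
  exact Finset.sum_eq_zero fun a _ => by rw [hz a, mul_zero]

/-- **The `y`-first choice**: a dual derivation `∂_b` with `b` outside the `y`-classes kills every
`y`-coordinate of the generic point (the `y`-classes are algebraic over `ℂ[B_y]`, on which `∂_b`
vanishes). [folklore] -/
theorem dualDer_genPtG_inr_eq_zero {b : basisAll P} (hb : (b : CoordRingG P) ∉ ySet P)
    (i : Fin m) : dualDer P b (genPtG P (Sum.inr i)) = 0 := by
  classical
  -- `Ȳᵢ` is algebraic over `ℂ[B_y]` in the coordinate ring
  have halg : IsAlgebraic (Algebra.adjoin ℂ (basisY P)) (coordG P (Sum.inr i)) :=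
    (AlgebraicIndependent.matroid_isBasis_iff.1 (isBasis_basisY P)).2.2 _ ⟨i, rfl⟩
  -- an algebraic equation of `Ȳᵢ` over `ℂ[B_y]`, read in `K`
  obtain ⟨p₀, hp0, hp⟩ := halg
  let f : Algebra.adjoin ℂ (basisY P) →+* FuncFieldG P :=
    (algebraMap (CoordRingG P) (FuncFieldG P)).comp
      (algebraMap (Algebra.adjoin ℂ (basisY P)) (CoordRingG P))
  have hinjS : Function.Injective f :=
    (IsFractionRing.injective (CoordRingG P) (FuncFieldG P)).comp Subtype.val_injective
  have hp0' : p₀.map f ≠ 0 := fun h =>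
    hp0 (Polynomial.map_injective f hinjS (by rw [h, Polynomial.map_zero]))
  have hcoeff : ∀ n, dualDer P b ((p₀.map f).coeff n) = 0 := by
    intro n
    rw [Polynomial.coeff_map]
    -- `∂_b` kills the image of `ℂ[B_y]`
    have : ∀ a : CoordRingG P, a ∈ Algebra.adjoin ℂ (basisY P) →
        dualDer P b (algebraMap (CoordRingG P) (FuncFieldG P) a) = 0 := by
      intro a ha
      refine Algebra.adjoin_induction (fun x hx => ?_) (fun r => ?_) (fun x y _ _ hx hy => ?_)
        (fun x y _ _ hx hy => ?_) ha
      · have hx' : x ∈ basisAll P := basisY_subset_basisAll P hx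
        have hxY : x ∈ ySet P := by
          have := (basisAll_inter_ySet P).symm ▸ hx
          exact this.2
        have hne : b ≠ ⟨x, hx'⟩ := fun h => hb (by rw [h]; exact hxY)
        have := dualDer_bK P b ⟨x, hx'⟩
        rw [if_neg hne] at this
        exact this
      · rw [← IsScalarTower.algebraMap_apply]
        exact (dualDer P b).map_algebraMap r
      · rw [map_add, map_add, hx, hy, add_zero]
      · rw [map_mul, Derivation.leibniz, hx, hy, smul_zero, smul_zero, add_zero]
    exact this _ (p₀.coeff n).2
  have heval : (p₀.map f).eval (genPtG P (Sum.inr i)) = 0 := by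
    rw [Polynomial.aeval_def] at hp
    rw [Polynomial.eval_map, genPtG]
    show Polynomial.eval₂ ((algebraMap (CoordRingG P) (FuncFieldG P)).comp
      (algebraMap (Algebra.adjoin ℂ (basisY P)) (CoordRingG P)))
      (algebraMap (CoordRingG P) (FuncFieldG P) (coordG P (Sum.inr i))) p₀ = 0
    rw [← Polynomial.hom_eval₂, hp, map_zero]
  have := Rosenlicht.derivation_mem_of_eval_eq_zero (dualDer P b) ⊥ hp0'
    (fun n => by rw [hcoeff n]; exact Submodule.zero_mem _) heval
  rwa [Submodule.mem_bot] at this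

end Basis

/-! ### The field of formal logarithms and its derivations -/

section LogField

variable (P : Ideal (MvPolynomial (Fin N' ⊕ Fin m) ℂ)) [P.IsPrime]

/-- The field `L = K(x₁, …, x_m)` of formal logarithms of the torus block. [folklore] -/
abbrev LogFieldG : Type := FractionRing (MvPolynomial (Fin m) (FuncFieldG P))

/-- `L` has characteristic zero. [folklore] -/
instance charZero_logFieldG : CharZero (LogFieldG P) :=
  charZero_of_injective_algebraMap (algebraMap ℂ (LogFieldG P)).injective

/-- The formal logarithms `xₗ ∈ L`. [folklore] -/
def logXG (l : Fin m) : LogFieldG P :=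
  algebraMap (MvPolynomial (Fin m) (FuncFieldG P)) (LogFieldG P) (X l)

/-- The torus block of the generic point, in `L`. [folklore] -/
def yL (i : Fin m) : LogFieldG P := algebraMap (FuncFieldG P) (LogFieldG P) (genPtG P (Sum.inr i))

/-- The additive block of the generic point, in `L`. [folklore] -/
def uL (s : Fin N') : LogFieldG P := algebraMap (FuncFieldG P) (LogFieldG P) (genPtG P (Sum.inl s))

omit [P.IsPrime] in
/-- The `xₗ` are algebraically independent over `K`. [folklore] -/
theorem algebraicIndependent_logXG : AlgebraicIndependent (FuncFieldG P) (logXG P) :=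
  (algebraicIndependent_X (Fin m) (FuncFieldG P)).map'
    (f := IsScalarTower.toAlgHom (FuncFieldG P) (MvPolynomial (Fin m) (FuncFieldG P)) (LogFieldG P))
    (IsFractionRing.injective (MvPolynomial (Fin m) (FuncFieldG P)) (LogFieldG P))

/-- The torus coordinates are non-zero in `L` when no `Y_i` lies in `P`. [folklore] -/
theorem yL_ne_zero (hP : ∀ i, (X (Sum.inr i) : MvPolynomial (Fin N' ⊕ Fin m) ℂ) ∉ P) (i : Fin m) :
    yL P i ≠ 0 := by
  rw [yL, map_ne_zero_iff _ (algebraMap (FuncFieldG P) (LogFieldG P)).injective]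
  exact genPtG_ne_zero P (hP i)

/-- The partial derivatives `∂/∂xₗ` of `L/K`. [cite: Rosenlicht1976, Prop. 3] -/
theorem exists_coordDerivationG (l : Fin m) :
    ∃ E : Derivation (FuncFieldG P) (LogFieldG P) (LogFieldG P),
      ∀ l', E (logXG P l') = if l' = l then 1 else 0 := by
  classical
  exact exists_derivation_of_algebraicIndependent (k := FuncFieldG P) (K := LogFieldG P)
    (algebraicIndependent_logXG P) _

/-- **Extension with prescribed values on the logarithms** (as in `WeakCIT.exists_extension`).
[cite: Rosenlicht1976, Prop. 3] -/
theorem exists_extensionG (δ : Derivation ℂ (FuncFieldG P) (FuncFieldG P)) (w : Fin m → LogFieldG P) :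
    ∃ Dδ : Derivation ℂ (LogFieldG P) (LogFieldG P),
      (∀ z, Dδ (algebraMap (FuncFieldG P) (LogFieldG P) z) = algebraMap _ _ (δ z)) ∧
      ∀ l, Dδ (logXG P l) = w l := by
  classical
  obtain ⟨d₀, hd₀⟩ := Derivation.exists_extension_of_charZero (R := ℂ) (F := FuncFieldG P)
    (T := LogFieldG P) (M := LogFieldG P) ((Algebra.linearMap (FuncFieldG P) (LogFieldG P)).compDer δ)
  choose E hE using exists_coordDerivationG P
  refine ⟨d₀ + ∑ i, (w i - d₀ (logXG P i)) • (E i).restrictScalars ℂ, fun z => ?_, fun l => ?_⟩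
  · rw [Derivation.add_apply, hd₀]
    have : (∑ i, (w i - d₀ (logXG P i)) • (E i).restrictScalars ℂ)
        (algebraMap (FuncFieldG P) (LogFieldG P) z) = 0 := by
      have h := congrFun (map_sum Derivation.coeFnAddMonoidHom
        (fun i => (w i - d₀ (logXG P i)) • (E i).restrictScalars ℂ) Finset.univ)
        (algebraMap (FuncFieldG P) (LogFieldG P) z)
      rw [Derivation.coeFnAddMonoidHom_apply, Finset.sum_apply] at h
      rw [h]
      refine Finset.sum_eq_zero fun i _ => ?_
      rw [Derivation.coeFnAddMonoidHom_apply, Derivation.coe_smul, Pi.smul_apply,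
        Derivation.restrictScalars_apply, Derivation.map_algebraMap, smul_zero]
    rw [this, add_zero]
    rfl
  · rw [Derivation.add_apply]
    have : (∑ i, (w i - d₀ (logXG P i)) • (E i).restrictScalars ℂ) (logXG P l) =
        w l - d₀ (logXG P l) := by
      have h := congrFun (map_sum Derivation.coeFnAddMonoidHom
        (fun i => (w i - d₀ (logXG P i)) • (E i).restrictScalars ℂ) Finset.univ) (logXG P l)
      rw [Derivation.coeFnAddMonoidHom_apply, Finset.sum_apply] at h
      rw [h]
      have h2 : ∀ i, (Derivation.coeFnAddMonoidHom ((w i - d₀ (logXG P i)) • (E i).restrictScalars ℂ))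
          (logXG P l) = if l = i then w i - d₀ (logXG P i) else 0 := fun i => by
        rw [Derivation.coeFnAddMonoidHom_apply, Derivation.coe_smul, Pi.smul_apply,
          Derivation.restrictScalars_apply, hE i l, smul_eq_mul]
        split_ifs <;> simp
      simp only [h2, Finset.sum_ite_eq, Finset.mem_univ, if_true]
    rw [this, add_sub_cancel]

/-- The extension of `∂ₐ` to `L`, normalised by `D xₗ = ∂ₐ(yₗ) / yₗ`. [folklore] -/
def extDer (a : basisAll P) : Derivation ℂ (LogFieldG P) (LogFieldG P) :=
  (exists_extensionG P (dualDer P a)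
    (fun l => algebraMap (FuncFieldG P) (LogFieldG P) (dualDer P a (genPtG P (Sum.inr l))) *
      (yL P l)⁻¹)).choose

/-- `extDer a` extends `∂ₐ`. [folklore] -/
theorem extDer_algebraMap (a : basisAll P) (z : FuncFieldG P) :
    extDer P a (algebraMap (FuncFieldG P) (LogFieldG P) z) =
      algebraMap (FuncFieldG P) (LogFieldG P) (dualDer P a z) :=
  (exists_extensionG P (dualDer P a) _).choose_spec.1 z

/-- The values of `extDer a` on the logarithms. [folklore] -/
theorem extDer_logXG (a : basisAll P) (l : Fin m) :
    extDer P a (logXG P l) =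
      algebraMap (FuncFieldG P) (LogFieldG P) (dualDer P a (genPtG P (Sum.inr l))) * (yL P l)⁻¹ :=
  (exists_extensionG P (dualDer P a) _).choose_spec.2 l

/-- The derivations `D_j` of `L` (`j : Fin (N' + m)` ↔ a coordinate via `finSumFinEquiv`): the
extension of the dual derivation of the basis element at that coordinate, or `0`. [folklore] -/
def Dj (j : Fin (N' + m)) : Derivation ℂ (LogFieldG P) (LogFieldG P) := by
  classical
  exact if h : finSumFinEquiv.symm j ∈ Set.range (cof P) then extDer P h.choose else 0

/-- `D_j` at a basis coordinate. [folklore] -/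
theorem Dj_of_mem {j : Fin (N' + m)} (h : finSumFinEquiv.symm j ∈ Set.range (cof P)) :
    Dj P j = extDer P h.choose := by
  classical
  simp only [Dj, dif_pos h]

/-- `D_j = 0` off the basis coordinates. [folklore] -/
theorem Dj_of_not_mem {j : Fin (N' + m)} (h : finSumFinEquiv.symm j ∉ Set.range (cof P)) :
    Dj P j = 0 := by
  classical
  simp only [Dj, dif_neg h]

/-- `D_j` for `j` the coordinate of the basis element `b` is `extDer b`. [folklore] -/
theorem Dj_cof (b : basisAll P) : Dj P (finSumFinEquiv (cof P b)) = extDer P b := by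
  have h : finSumFinEquiv.symm (finSumFinEquiv (cof P b)) ∈ Set.range (cof P) := by
    rw [Equiv.symm_apply_apply]; exact ⟨b, rfl⟩
  rw [Dj_of_mem P h]
  congr 1
  apply cof_injective P
  rw [h.choose_spec, Equiv.symm_apply_apply]

/-- **The exponential differential equation** `D_j yᵢ = yᵢ D_j xᵢ`. [cite: Kirby2009, §3] -/
theorem Dj_yL (hP : ∀ i, (X (Sum.inr i) : MvPolynomial (Fin N' ⊕ Fin m) ℂ) ∉ P) (j : Fin (N' + m))
    (i : Fin m) : Dj P j (yL P i) = yL P i * Dj P j (logXG P i) := by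
  by_cases h : finSumFinEquiv.symm j ∈ Set.range (cof P)
  · rw [Dj_of_mem P h, yL, extDer_algebraMap, extDer_logXG, ← yL,
      mul_comm (algebraMap _ _ _) (yL P i)⁻¹, ← mul_assoc, mul_inv_cancel₀ (yL_ne_zero P hP i),
      one_mul]
  · rw [Dj_of_not_mem P h, Derivation.zero_apply, Derivation.zero_apply, mul_zero]

/-- A basis element at a torus coordinate is a `y`-class, of weight itself. [folklore] -/
theorem wt_eq_of_cof_eq_inr {b : basisAll P} {i : Fin m} (h : cof P b = Sum.inr i) :
    (b : CoordRingG P) ∈ ySet P ∧ wt P b = bK P b ∧ genPtG P (Sum.inr i) = bK P b := by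
  classical
  have hb : (b : CoordRingG P) = coordG P (Sum.inr i) := by rw [← cof_spec P b, h]
  have hY : (b : CoordRingG P) ∈ ySet P := ⟨i, hb.symm⟩
  refine ⟨hY, by simp only [wt, if_pos hY], ?_⟩
  rw [← genPtG_cof, h]

/-- A basis element at an additive coordinate is not a `y`-class, of weight `1`. [folklore] -/
theorem wt_eq_of_cof_eq_inl {b : basisAll P} {s : Fin N'} (h : cof P b = Sum.inl s) :
    (b : CoordRingG P) ∉ ySet P ∧ wt P b = 1 ∧ genPtG P (Sum.inl s) = bK P b := by
  classical
  have hY : (b : CoordRingG P) ∉ ySet P := fun hY => by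
    obtain ⟨i, hi⟩ := cof_isRight_of_mem P hY
    rw [h] at hi
    exact Sum.inl_ne_inr hi
  refine ⟨hY, by simp only [wt, if_neg hY], ?_⟩
  rw [← genPtG_cof, h]

/-- **The Jacobian is the identity on `S_y`**: `D_j xᵢ = δ` for `i ∈ S_y`.
[cite: Kirby2009, Thm 4.6 (proof)] -/
theorem Dj_logXG (hP : ∀ i, (X (Sum.inr i) : MvPolynomial (Fin N' ⊕ Fin m) ℂ) ∉ P) {i : Fin m}
    (hi : i ∈ Sy P) (j : Fin (N' + m)) :
    Dj P j (logXG P i) = (Pi.single (finSumFinEquiv (Sum.inr i)) (1 : LogFieldG P) : _ → _) j := by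
  classical
  obtain ⟨b₀, hb₀⟩ := (mem_Sy_iff P).1 hi
  obtain ⟨-, hwt, hgen⟩ := wt_eq_of_cof_eq_inr P hb₀
  by_cases h : finSumFinEquiv.symm j ∈ Set.range (cof P)
  · rw [Dj_of_mem P h, extDer_logXG, hgen, dualDer_bK]
    by_cases hbb : h.choose = b₀
    · rw [if_pos hbb, hwt, ← hgen, ← yL, mul_inv_cancel₀ (yL_ne_zero P hP i)]
      have hj : j = finSumFinEquiv (Sum.inr i) := by
        rw [← hb₀, ← hbb, h.choose_spec, Equiv.apply_symm_apply]
      rw [hj, Pi.single_eq_same]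
    · rw [if_neg hbb, map_zero, zero_mul]
      have hj : j ≠ finSumFinEquiv (Sum.inr i) := fun hj => hbb (by
        apply cof_injective P
        rw [h.choose_spec, hj, Equiv.symm_apply_apply, hb₀])
      rw [Pi.single_eq_of_ne hj]
  · rw [Dj_of_not_mem P h, Derivation.zero_apply]
    have hj : j ≠ finSumFinEquiv (Sum.inr i) := fun hj => h (by
      rw [hj, Equiv.symm_apply_apply, ← hb₀]; exact ⟨b₀, rfl⟩)
    rw [Pi.single_eq_of_ne hj]

/-- **The Jacobian is the identity on `S_u`**: `D_j u_s = δ` for `s ∈ S_u`.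
[cite: Kirby2009, Thm 4.6 (proof)] -/
theorem Dj_uL {s : Fin N'} (hs : s ∈ Su P) (j : Fin (N' + m)) :
    Dj P j (uL P s) = (Pi.single (finSumFinEquiv (Sum.inl s)) (1 : LogFieldG P) : _ → _) j := by
  classical
  obtain ⟨b₀, hb₀⟩ := (mem_Su_iff P).1 hs
  obtain ⟨-, hwt, hgen⟩ := wt_eq_of_cof_eq_inl P hb₀
  by_cases h : finSumFinEquiv.symm j ∈ Set.range (cof P)
  · rw [Dj_of_mem P h, uL, hgen, extDer_algebraMap, dualDer_bK]
    by_cases hbb : h.choose = b₀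
    · rw [if_pos hbb, hwt, map_one]
      have hj : j = finSumFinEquiv (Sum.inl s) := by
        rw [← hb₀, ← hbb, h.choose_spec, Equiv.apply_symm_apply]
      rw [hj, Pi.single_eq_same]
    · rw [if_neg hbb, map_zero]
      have hj : j ≠ finSumFinEquiv (Sum.inl s) := fun hj => hbb (by
        apply cof_injective P
        rw [h.choose_spec, hj, Equiv.symm_apply_apply, hb₀])
      rw [Pi.single_eq_of_ne hj]
  · rw [Dj_of_not_mem P h, Derivation.zero_apply]
    have hj : j ≠ finSumFinEquiv (Sum.inl s) := fun hj => h (by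
      rw [hj, Equiv.symm_apply_apply, ← hb₀]; exact ⟨b₀, rfl⟩)
    rw [Pi.single_eq_of_ne hj]

/-- **The derivations of index in `S_u` kill the torus block** (the `y`-first choice of basis).
[folklore] -/
theorem Dj_inl_yL {s : Fin N'} (hs : s ∈ Su P) (i : Fin m) :
    Dj P (finSumFinEquiv (Sum.inl s)) (yL P i) = 0 := by
  obtain ⟨b₀, hb₀⟩ := (mem_Su_iff P).1 hs
  obtain ⟨hY, -, -⟩ := wt_eq_of_cof_eq_inl P hb₀
  rw [← hb₀, Dj_cof, yL, extDer_algebraMap, dualDer_genPtG_inr_eq_zero P hY, map_zero]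

/-- **Genericity in `L`**: a polynomial over `ℂ` vanishes at `(u, y) ∈ L^{N' ⊕ m}` iff it lies in `P`.
[cite: Marker2006, §1] -/
theorem aeval_uL_yL_eq_zero_iff (p : MvPolynomial (Fin N' ⊕ Fin m) ℂ) :
    aeval (Sum.elim (uL P) (yL P)) p = 0 ↔ p ∈ P := by
  have helim : Sum.elim (uL P) (yL P) = algebraMap (FuncFieldG P) (LogFieldG P) ∘ genPtG P := by
    funext c; cases c <;> rfl
  have h : (aeval (Sum.elim (uL P) (yL P)) : MvPolynomial (Fin N' ⊕ Fin m) ℂ →ₐ[ℂ] LogFieldG P) =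
      (IsScalarTower.toAlgHom ℂ (FuncFieldG P) (LogFieldG P)).comp (aeval (genPtG P)) :=
    MvPolynomial.algHom_ext fun c => by rw [aeval_X, helim]; simp
  rw [h, AlgHom.comp_apply, IsScalarTower.coe_toAlgHom',
    map_eq_zero_iff (algebraMap (FuncFieldG P) (LogFieldG P))
      (algebraMap (FuncFieldG P) (LogFieldG P)).injective,
    aeval_genPtG_eq_zero_iff]

/-- **Constant Laurent monomials in `y` are complex numbers.** [cite: Kirby2009, Thm 4.6 (proof)] -/
theorem exists_eq_algebraMap_of_forall_Dj
    (hP : ∀ i, (X (Sum.inr i) : MvPolynomial (Fin N' ⊕ Fin m) ℂ) ∉ P) (q : Fin m → ℤ)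
    (hq : ∀ j, Dj P j (∏ i, yL P i ^ q i) = 0) :
    ∃ c : ℂ, ∏ i, yL P i ^ q i = algebraMap ℂ (LogFieldG P) c := by
  set z : FuncFieldG P := ∏ i, genPtG P (Sum.inr i) ^ q i with hz
  have hyz : ∏ i, yL P i ^ q i = algebraMap (FuncFieldG P) (LogFieldG P) z := by
    simp only [hz, map_prod, map_zpow₀, yL]
  have hza : ∀ a : basisAll P, dualDer P a z = 0 := by
    intro a
    have h := hq (finSumFinEquiv (cof P a))
    rw [hyz, Dj_cof, extDer_algebraMap,
      map_eq_zero_iff _ (algebraMap (FuncFieldG P) (LogFieldG P)).injective] at h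
    exact h
  obtain ⟨c, hc⟩ := mem_range_of_forall_dualDer_eq_zero P hP hza
  refine ⟨c, ?_⟩
  rw [hyz, ← hc, ← IsScalarTower.algebraMap_apply]

/-- **Existence of two-block logarithmic points**: every prime `P ⊆ ℂ[U, Y]` containing no `Y_i`
is the ideal of a two-block logarithmic point, with `S_y`, `S_u` the chosen basis indices.
[cite: Kirby2009, Thm 4.6 (proof)] [cite: BaysKirby2018ANT, Thm 11.4 (proof)] -/
theorem exists_logPointG (hP : ∀ i, (X (Sum.inr i) : MvPolynomial (Fin N' ⊕ Fin m) ℂ) ∉ P) :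
    ∃ L : LogPointG N' m, L.P = P ∧ L.Sy = Sy P ∧ L.Su = Su P :=
  ⟨{ F := LogFieldG P
     u := uL P
     x := logXG P
     y := yL P
     D := Dj P
     Sy := Sy P
     Su := Su P
     P := P
     y_ne_zero := yL_ne_zero P hP
     map_y := Dj_yL P hP
     map_x := fun _ hi j => Dj_logXG P hP hi j
     map_u := fun _ hs j => Dj_uL P hs j
     map_u_y := fun _ hs i => Dj_inl_yL P hs i
     aeval_eq_zero_iff := aeval_uL_yL_eq_zero_iff P
     exists_eq_algebraMap := exists_eq_algebraMap_of_forall_Dj P hP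
     card_S := card_Sy_add_card_Su P }, rfl, rfl, rfl⟩

end LogField

/-! ### Logarithmic points of irreducible subvarieties of `𝔾ₐ^{N'} × 𝔾ₘ^m` -/

section Variety

/-- The torus condition on the multiplicative block of `ℂ^{N' ⊕ m}`. [cite: BaysKirby2018ANT, Thm 11.4 (`U × S`)] -/
def torus₂ (N' m : ℕ) : Set (Fin N' ⊕ Fin m → ℂ) := {z | ∀ i, z (Sum.inr i) ≠ 0}

/-- Membership in `torus₂`. [folklore] -/
@[simp] theorem mem_torus₂_iff {z : Fin N' ⊕ Fin m → ℂ} : z ∈ torus₂ N' m ↔ ∀ i, z (Sum.inr i) ≠ 0 :=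
  Iff.rfl

/-- If `X` lies in the torus part and is non-empty then no `Y_i` vanishes on `X`. [folklore] -/
theorem X_inr_notMem_vanishingIdeal {X : Set (Fin N' ⊕ Fin m → ℂ)} (hX : X ⊆ torus₂ N' m)
    (hne : X.Nonempty) (i : Fin m) :
    (MvPolynomial.X (Sum.inr i) : MvPolynomial (Fin N' ⊕ Fin m) ℂ) ∉ vanishingIdeal ℂ X := by
  obtain ⟨z, hz⟩ := hne
  intro h
  have := (mem_vanishingIdeal_iff.1 h) z hz
  rw [aeval_X] at this
  exact hX hz i this

/-- **Logarithmic points of irreducible subvarieties of `𝔾ₐ^{N'} × 𝔾ₘ^m`**: for `X` non-empty in the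
torus part with prime vanishing ideal there is a two-block logarithmic point with ideal `I(X)`; in
particular `dim X = |S_y| + |S_u|`. [cite: Kirby2009, Thm 4.6 (proof)] -/
theorem exists_logPointG_of_isPrime {X : Set (Fin N' ⊕ Fin m → ℂ)} (hX : X ⊆ torus₂ N' m)
    (hne : X.Nonempty) (hprime : (vanishingIdeal ℂ X).IsPrime) :
    ∃ L : LogPointG N' m, L.P = vanishingIdeal ℂ X ∧
      (((L.Sy.card + L.Su.card : ℕ) : ℕ∞) : WithBot ℕ∞) = zariskiDim ℂ X := by
  haveI := hprime
  obtain ⟨L, hLP, -, -⟩ := exists_logPointG (vanishingIdeal ℂ X) (X_inr_notMem_vanishingIdeal hX hne)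
  exact ⟨L, hLP, by rw [L.card_S, hLP]; rfl⟩

end Variety

end Literature.NumberTheory.Transcendental.WeakZP
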